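import Summits.AtomisticToContinuum.HydrodynamicLimit.Theses.CollisionIsometryCLT
import Literature.Analysis.FluidPDE.HardSphereFlowOrbits
import Literature.Analysis.FluidPDE.HardSphereRegularGeometry
import Literature.Analysis.FluidPDE.HardSphereFlowGroup
import Literature.Analysis.FluidPDE.HardSphereFlowMeasurable
import Literature.Analysis.FluidPDE.HardSphereAlexander
import Literature.Analysis.FluidPDE.HardSphereUniqueness

/-!
# drefute evidence for `Lines/contact-source-duhamel.lean`, stub 2 (`stub_flowDictionary`)

The typed fold of the line (`pre`, `stepMap`, `transferSteps`, `velAfter`, copied VERBATIM from the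
skeleton into the sub-namespace `Drefute`) reproduces the post-collisional velocities of Alexander's
collision-by-collision construction for EVERY configuration `y` and EVERY number of steps `m`, as soon
as `σ < 1/2` (regular torus geometry):

  `velAfter σ N y m = fun i => (Alexander.stateAfter G ε_N y m i).2`.

The only non-definitional point is the fold's missing `freeExitTime = ∞` guard: there `pre k = S_0 z_k
= z_k`, and a post-collisional/terminal state has no incoming contact pair because an incoming contact
pair forces `τ = 0` (`Alexander.freeExitTime_eq_zero_of_isIncoming`).  Consequently the velocities of
`Alexander.fwdFlow y Δ` are `velAfter σ N y (steps σ N y Δ)` for every `y`, `Δ` (free flight keeps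
velocities), and `FlowDictionary σ` reduces to the a.e. identification `Φ_{s+Δ} z = fwdFlow (Φ_s z) Δ`
(forward uniqueness `IsHardSphereTrajectory.unique_holds` + `torusFlow_*_holds`, all in tree).
-/

namespace Summit.AtomisticToContinuum.HydrodynamicLimit.Cruxes.AdaptedWeightCLT.ContactSourceDuhamel.Drefute

open scoped BigOperators Topology Classical ENNReal
open Filter Set MeasureTheory
open Literature.Analysis.FluidPDE Literature.MathematicalPhysics.KineticTheory

noncomputable section

abbrev T3 : Type := UnitAddTorus (Fin 3)
abbrev V3 : Type := EuclideanSpace ℝ (Fin 3)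
abbrev Cfg (N : ℕ) : Type := Literature.Analysis.FluidPDE.Config (N + 1) (Fin 3) T3
abbrev Vel (N : ℕ) : Type := Fin (N + 1) → V3

/-- Verbatim copy of the skeleton's `pre`. -/
def pre (σ : ℝ) (N : ℕ) (y : Cfg N) (k : ℕ) : Cfg N :=
  Literature.Analysis.FluidPDE.freeFlight (Literature.Analysis.FluidPDE.Torus.geometry (Fin 3))
    (Literature.Analysis.FluidPDE.Alexander.freeExitTime
      (Literature.Analysis.FluidPDE.Torus.geometry (Fin 3))
      (Literature.MathematicalPhysics.KineticTheory.hsDiameter σ N)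
      (Literature.Analysis.FluidPDE.Alexander.stateAfter
        (Literature.Analysis.FluidPDE.Torus.geometry (Fin 3))
        (Literature.MathematicalPhysics.KineticTheory.hsDiameter σ N) y k)).toReal
    (Literature.Analysis.FluidPDE.Alexander.stateAfter
      (Literature.Analysis.FluidPDE.Torus.geometry (Fin 3))
      (Literature.MathematicalPhysics.KineticTheory.hsDiameter σ N) y k)

/-- Verbatim copy of the skeleton's `stepMap`. -/
def stepMap (σ : ℝ) (N : ℕ) (y : Cfg N) (k : ℕ) (W : Vel N) : Vel N :=
  @dite (Fin (N + 1) → EuclideanSpace ℝ (Fin 3))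
    (Literature.Analysis.FluidPDE.Alexander.incomingPairs
      (Literature.Analysis.FluidPDE.Torus.geometry (Fin 3))
      (Literature.MathematicalPhysics.KineticTheory.hsDiameter σ N) (pre σ N y k)).Nonempty
    (Classical.propDecidable _)
    (fun h => fun i => (Literature.Analysis.FluidPDE.collidePair
      (Literature.Analysis.FluidPDE.Torus.geometry (Fin 3)) h.some.1 h.some.2
      (fun j => ((pre σ N y k j).1, W j)) i).2)
    (fun _ => W)

/-- Verbatim copy of the skeleton's `transferSteps`. -/
def transferSteps (σ : ℝ) (N : ℕ) (y : Cfg N) (m : ℕ) (W : Vel N) : Vel N :=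
  (List.range m).foldl (fun W' k => stepMap σ N y k W') W

/-- Verbatim copy of the skeleton's `steps`. -/
def steps (σ : ℝ) (N : ℕ) (y : Cfg N) (s : ℝ) : ℕ :=
  Literature.Analysis.FluidPDE.Alexander.collisionCount
    (Literature.Analysis.FluidPDE.Torus.geometry (Fin 3))
    (Literature.MathematicalPhysics.KineticTheory.hsDiameter σ N) y s

/-- Verbatim copy of the skeleton's `velAfter`. -/
def velAfter (σ : ℝ) (N : ℕ) (y : Cfg N) (m : ℕ) : Vel N :=
  transferSteps σ N y m (fun i => (y i).2)

/-- `ε_N = σ (N+1)^{-1/3} < 1/2` whenever `σ < 1/2` (no positivity needed). -/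
theorem hsDiameter_lt_half {σ : ℝ} (hσ : σ < 2⁻¹) (N : ℕ) : hsDiameter σ N < 2⁻¹ := by
  unfold hsDiameter
  have hpos : (0 : ℝ) < ((N + 1 : ℕ) : ℝ) ^ (-(1 / 3 : ℝ)) := by positivity
  have hle : ((N + 1 : ℕ) : ℝ) ^ (-(1 / 3 : ℝ)) ≤ 1 := by
    apply Real.rpow_le_one_of_one_le_of_nonpos
    · exact_mod_cast Nat.succ_le_succ (Nat.zero_le N)
    · norm_num
  by_cases h0 : 0 ≤ σ
  · calc σ * ((N + 1 : ℕ) : ℝ) ^ (-(1 / 3 : ℝ)) ≤ σ * 1 := by gcongr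
      _ < 2⁻¹ := by simpa using hσ
  · have h0' : σ < 0 := lt_of_not_ge h0
    calc σ * ((N + 1 : ℕ) : ℝ) ^ (-(1 / 3 : ℝ)) < 0 := mul_neg_of_neg_of_pos h0' hpos
      _ < 2⁻¹ := by norm_num

/-- One fold step applied to the velocities of `z_k` gives the velocities of `z_{k+1}`. -/
theorem stepMap_stateAfter {σ : ℝ} (hσ : σ < 2⁻¹) (N : ℕ) (y : Cfg N) (k : ℕ) :
    stepMap σ N y k (fun i => (Alexander.stateAfter (Torus.geometry (Fin 3)) (hsDiameter σ N) y k i).2)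
      = fun i => (Alexander.collisionStep (Torus.geometry (Fin 3)) (hsDiameter σ N)
          (Alexander.stateAfter (Torus.geometry (Fin 3)) (hsDiameter σ N) y k) i).2 := by
  set G := Torus.geometry (Fin 3) with hG
  set ε := hsDiameter σ N with hε
  set z := Alexander.stateAfter G ε y k with hz
  have hreg : G.IsHardSphereRegular ε := Torus.isHardSphereRegular_geometry (hsDiameter_lt_half hσ N)
  -- placing the velocities of `z` at the positions of `pre k = S_τ z` gives back `S_τ z`
  have hW : (fun j => ((pre σ N y k j).1, (z j).2)) = pre σ N y k := by
    funext j; rfl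
  have hpre : pre σ N y k = freeFlight G (Alexander.freeExitTime G ε z).toReal z := rfl
  by_cases hτ : Alexander.freeExitTime G ε z = ∞
  · -- no further collision: `collisionStep z = z`, and the fold step is the identity too
    rw [Alexander.collisionStep_of_eq_top hτ]
    have h0 : pre σ N y k = z := by
      rw [hpre, hτ, ENNReal.toReal_top, freeFlight_zero]
    have hno : ¬ (Alexander.incomingPairs G ε (pre σ N y k)).Nonempty := by
      rintro ⟨p, hp⟩
      rw [h0] at hp
      rcases hp with ⟨hlt, hc, hin⟩
      have := Alexander.freeExitTime_eq_zero_of_isIncoming hreg (ne_of_lt hlt) hc hin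
      rw [this] at hτ
      exact ENNReal.zero_ne_top hτ
    unfold stepMap
    rw [dif_neg hno]
  · rw [Alexander.collisionStep, if_neg hτ]
    unfold stepMap
    simp only
    by_cases h : (Alexander.incomingPairs G ε (pre σ N y k)).Nonempty
    · have h' : (Alexander.incomingPairs G ε (freeFlight G (Alexander.freeExitTime G ε z).toReal z)).Nonempty := by
        rwa [hpre] at h
      rw [dif_pos h, dif_pos h', hW]
      rfl
    · have h' : ¬ (Alexander.incomingPairs G ε (freeFlight G (Alexander.freeExitTime G ε z).toReal z)).Nonempty := by
        rwa [hpre] at h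
      rw [dif_neg h, dif_neg h']
      rfl

/-- **The typed fold is Alexander's construction (velocities), for every configuration.** -/
theorem velAfter_eq_stateAfter {σ : ℝ} (hσ : σ < 2⁻¹) (N : ℕ) (y : Cfg N) (m : ℕ) :
    velAfter σ N y m
      = fun i => (Alexander.stateAfter (Torus.geometry (Fin 3)) (hsDiameter σ N) y m i).2 := by
  induction m with
  | zero => rfl
  | succ m ih =>
    have hstep : velAfter σ N y (m + 1) = stepMap σ N y m (velAfter σ N y m) := by
      unfold velAfter transferSteps
      rw [List.range_succ, List.foldl_append, List.foldl_cons, List.foldl_nil]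
    rw [hstep, ih, stepMap_stateAfter hσ]
    funext i
    rw [Alexander.stateAfter_succ]

/-- Corollary: the velocities of the forward flow at time `Δ` are the fold over `steps … Δ` steps. -/
theorem fwdFlow_snd_eq_velAfter {σ : ℝ} (hσ : σ < 2⁻¹) (N : ℕ) (y : Cfg N) (Δ : ℝ) :
    (fun i => (Alexander.fwdFlow (Torus.geometry (Fin 3)) (hsDiameter σ N) y Δ i).2)
      = velAfter σ N y (steps σ N y Δ) := by
  rw [velAfter_eq_stateAfter hσ]
  rfl


/-! ## The full dictionary (stub 2 of the line, with this file's verbatim copies of the defs) -/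

/-- Verbatim copy of the skeleton's `Flow`. -/
abbrev Flow (σ : ℝ) (N : ℕ) : Type :=
  Literature.Analysis.FluidPDE.HardSphereFlow (Literature.Analysis.FluidPDE.Torus.geometry (Fin 3))
    (Literature.MathematicalPhysics.KineticTheory.hsDiameter σ N) (N + 1)

/-- Verbatim copy of the skeleton's `FlowDictionary`. -/
def FlowDictionary (σ : ℝ) : Prop :=
  ∀ (N : ℕ) (Φ : Flow σ N),
    ∀ᵐ z ∂(Literature.Analysis.FluidPDE.liouville (Literature.Analysis.FluidPDE.Torus.geometry (Fin 3))
      (N + 1) (Literature.MathematicalPhysics.KineticTheory.hsDiameter σ N)),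
      ∀ s Δ : ℝ, 0 ≤ Δ →
        (fun i => (Φ.flow (s + Δ) z i).2) = velAfter σ N (Φ.flow s z) (steps σ N (Φ.flow s z) Δ)

theorem hsDiameter_pos' {σ : ℝ} (hσ : 0 < σ) (N : ℕ) : 0 < hsDiameter σ N := by
  unfold hsDiameter; positivity

/-- **Stub 2 of the line (`stub_flowDictionary`), proved**: for `0 < σ < 1/2`, along EVERY hard-sphere
flow `Φ` of `N+1` spheres of diameter `ε_N`, for Liouville-a.e. `z`, simultaneously for all `s ∈ ℝ` and
`Δ ≥ 0`, the velocities of `Φ_{s+Δ} z` are the typed fold over `[0, Δ]` restarted at `Φ_s z`.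
Proof: on the conull set `Φ.good ∩ ⋂_{q ∈ ℚ} Φ_q⁻¹ Γ₀` pick a rational `q < s`; forward uniqueness of
hard-sphere trajectories identifies `u ↦ Φ_u (Φ_q z)` with Alexander's `u ↦ T^u (Φ_q z)` on `u ≥ 0`;
the group law on `Γ₀` gives `Φ_{s+Δ} z = T^Δ (Φ_s z) = fwdFlow (Φ_s z) Δ`, whose velocities are the
fold (`fwdFlow_snd_eq_velAfter`). -/
theorem flowDictionary_holds : ∀ σ : ℝ, 0 < σ → σ < 2⁻¹ → FlowDictionary σ := by
  intro σ hσ hσ' N Φ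
  have hε0 : 0 < hsDiameter σ N := hsDiameter_pos' hσ N
  have hε : hsDiameter σ N < 2⁻¹ := hsDiameter_lt_half hσ' N
  obtain ⟨-, hzero, hadd⟩ := Alexander.torusFlow_group_holds (d := Fin 3) hε0 hε (N + 1)
  have htraj := Alexander.torusFlow_isTrajectory_holds (d := Fin 3) hε0 hε (N + 1)
  have haegood : ∀ᵐ z ∂(liouville (Torus.geometry (Fin 3)) (N + 1) (hsDiameter σ N)),
      z ∈ Alexander.good (N := N + 1) (Torus.geometry (Fin 3)) (hsDiameter σ N) :=
    mem_ae_iff.2 (Alexander.torusFlow_ae_good_holds (d := Fin 3) hε0 hε (N + 1))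
  have hpre : ∀ q : ℚ, ∀ᵐ z ∂(liouville (Torus.geometry (Fin 3)) (N + 1) (hsDiameter σ N)),
      Φ.flow (q : ℝ) z ∈ Alexander.good (N := N + 1) (Torus.geometry (Fin 3)) (hsDiameter σ N) :=
    fun q => (Φ.measurePreserving (q : ℝ)).quasiMeasurePreserving.ae haegood
  have hall : ∀ᵐ z ∂(liouville (Torus.geometry (Fin 3)) (N + 1) (hsDiameter σ N)),
      ∀ q : ℚ, Φ.flow (q : ℝ) z ∈ Alexander.good (N := N + 1) (Torus.geometry (Fin 3)) (hsDiameter σ N) :=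
    ae_all_iff.2 hpre
  filter_upwards [Φ.ae_mem_good, hall] with z hz hq
  intro s Δ hΔ
  obtain ⟨q, hqs⟩ := exists_rat_lt s
  have hwgood : Φ.flow (q : ℝ) z ∈ Φ.good := Φ.mapsTo_good (q : ℝ) hz
  have hwA := hq q
  -- forward uniqueness: `Φ_u w = T^u w` for `u ≥ 0`, `w = Φ_q z`
  have hEq : EqOn (fun u => Φ.flow u (Φ.flow (q : ℝ) z))
      (fun u => Alexander.flow (Torus.geometry (Fin 3)) (hsDiameter σ N) u (Φ.flow (q : ℝ) z)) (Ici 0) := by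
    refine IsHardSphereTrajectory.unique_holds (Φ.isTrajectory _ hwgood) (htraj _ hwA) ?_
    show Φ.flow 0 (Φ.flow (q : ℝ) z) = Alexander.flow (Torus.geometry (Fin 3)) (hsDiameter σ N) 0 (Φ.flow (q : ℝ) z)
    rw [Φ.flow_zero _ hwgood, hzero _ hwA]
  have hs : Φ.flow s z = Alexander.flow (Torus.geometry (Fin 3)) (hsDiameter σ N) (s - q) (Φ.flow (q : ℝ) z) := by
    calc Φ.flow s z = Φ.flow ((s - q) + q) z := by rw [sub_add_cancel]
      _ = Φ.flow (s - q) (Φ.flow (q : ℝ) z) := Φ.flow_add (s - q) q z hz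
      _ = Alexander.flow (Torus.geometry (Fin 3)) (hsDiameter σ N) (s - q) (Φ.flow (q : ℝ) z) :=
          hEq (show (s - q : ℝ) ∈ Ici (0 : ℝ) from Set.mem_Ici.2 (by linarith))
  have hsΔ : Φ.flow (s + Δ) z = Alexander.flow (Torus.geometry (Fin 3)) (hsDiameter σ N) Δ (Φ.flow s z) := by
    calc Φ.flow (s + Δ) z = Φ.flow ((s + Δ - q) + q) z := by rw [sub_add_cancel]
      _ = Φ.flow (s + Δ - q) (Φ.flow (q : ℝ) z) := Φ.flow_add (s + Δ - q) q z hz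
      _ = Alexander.flow (Torus.geometry (Fin 3)) (hsDiameter σ N) (s + Δ - q) (Φ.flow (q : ℝ) z) :=
          hEq (show (s + Δ - q : ℝ) ∈ Ici (0 : ℝ) from Set.mem_Ici.2 (by linarith))
      _ = Alexander.flow (Torus.geometry (Fin 3)) (hsDiameter σ N) (Δ + (s - q)) (Φ.flow (q : ℝ) z) := by
          rw [show (s + Δ - q : ℝ) = Δ + (s - q) by ring]
      _ = Alexander.flow (Torus.geometry (Fin 3)) (hsDiameter σ N) Δ
            (Alexander.flow (Torus.geometry (Fin 3)) (hsDiameter σ N) (s - q) (Φ.flow (q : ℝ) z)) :=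
          hadd Δ (s - q) _ hwA
      _ = Alexander.flow (Torus.geometry (Fin 3)) (hsDiameter σ N) Δ (Φ.flow s z) := by rw [hs]
  have hflow : Alexander.flow (Torus.geometry (Fin 3)) (hsDiameter σ N) Δ (Φ.flow s z)
      = Alexander.fwdFlow (Torus.geometry (Fin 3)) (hsDiameter σ N) (Φ.flow s z) Δ := by
    unfold Alexander.flow
    rw [if_pos hΔ]
  rw [hsΔ, hflow]
  exact fwdFlow_snd_eq_velAfter hσ' N (Φ.flow s z) Δ


/-! ## Corollary: the route's support item `TransferRepresentsFlow` (stmt-AtomisticToContinuum-12952) -/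

/-- **`CollisionIsometryCLT.TransferRepresentsFlow` (stmt-12952), proved** — the per-`(s, Δ)` a.e.
form follows from the uniform-in-`(s, Δ)` dictionary `flowDictionary_holds`; the route decl's inlined
`let M` applied to the velocities of `Φ_s z` is this file's `velAfter σ N (Φ_s z) (steps σ N (Φ_s z) Δ)`
by `ζδ`-reduction. -/
theorem transferRepresentsFlow_holds :
    Summit.AtomisticToContinuum.HydrodynamicLimit.Theses.CollisionIsometryCLT.TransferRepresentsFlow := by
  intro σ hσ hσ' M N Φ s Δ hΔ
  filter_upwards [flowDictionary_holds σ hσ hσ' N Φ] with z hz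
  exact hz s Δ hΔ

end

end Summit.AtomisticToContinuum.HydrodynamicLimit.Cruxes.AdaptedWeightCLT.ContactSourceDuhamel.Drefute
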